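import Summits.AtomisticToContinuum.Crystallization.Theorems.ChartedZeroExcessLayeredLatticeLiouvilleTZ

/-!
# Zero-excess layered lattice Liouville — part TZM (lens-2 g42 node «StrainSparseReformulation», main): the threshold form (M♭) of (M)

(Second half of the node; the helpers — window sums, `winDensC`, the radius shifts `IsGlobalReg.radius_add_four/_of_add_four`, `bondDistSup`,
`strainMassAbove` — are part TZ, imported here.)

(M) `StrainNonConcentrationPG` (part TR) asks, on fat windows of θ-good GSC door sets registered to an equilibrium chart, for a RE-registration
whose tilt–strain data `(Q, σ)` have cubic strain moment `Σ_{win R} σ³ ≤ ε·η·nK(win R)`.  This part files its THRESHOLD REFORMULATION, the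
one-parameter family

  (M♭)_ϑ `StrainSparsePG ϑ aHi Λ θ s`: for every threshold `t₀ ≥ ϑ` with `t₀ > 0` and every `ε > 0` (then `K₀`, then `η₁, R₁`), a re-registration
  with tilt–strain data whose strain MASS ABOVE `t₀`, `strainMassAbove t₀ (win R) σ = Σ_{x ∈ win R, σ x ≥ t₀} σ x²`, is `≤ ε·η·nK(win R)`,

and proves (sorry-free):
* `strainSparsePG_of_strainNonConcentrationPG` : (M) ⇒ (M♭)_ϑ for every `ϑ` (Chebyshev: the mass above `t₀` is `≤ Σσ³/t₀`);
* `strainNonConcentrationPG_of_strainSparsePG` : (M♭)₀ ⇒ (M) (`aHi ≤ 8/7`) — the SUB-threshold part is FREE: merging the data pointwise with the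
  identity data `(1, τ⁺)` of the registration profile `τ` of the re-registration at scale `R + 4` and truncating at `12` (tear-free `4 ↦ 8`) gives
  data with `σ' ≤ σ`, `σ' ≤ τ⁺`, `σ' ≤ 12`, whence `Σσ'³ ≤ t₀·Σ_{win (R+4)} τ² + 12·strainMassAbove t₀ ≤ (2c²·Cg'·t₀ + 12·ε♭)·η·nK(win R)` with the window
  density ratio `c = winDensC δ = (10(2/δ+1))³` of part TV (K_dens), and `t₀ := ε/(8c²Cg')`, `ε♭ := ε/24` close;
* `strainNonConcentrationPG_iff_strainSparsePG_zero` : (M) ⟺ (M♭)₀ (`aHi ≤ 8/7`);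
* `StrainSparsePG.mono` : (M♭)_ϑ ⇒ (M♭)_ϑ' for `ϑ ≤ ϑ'`;
* `strainSparsePG_tameRadius_of_wildFractionPG` : (R_W) `WildFractionPG` ⇒ (M♭)_{ϑ₀}, `ϑ₀ = tameRadius = 1/20` (`aHi ≤ 8/7`): apply (R_W) at
  radius `R + 4` (a global registration at `(Cg, η, R)` is one at `(2Cg, η, R + 4)` — `IsGlobalReg.radius_add_four`; one at `(Cg', η, R + 4)` is one
  at `(4c²Cg', η, R)` on door sets — `IsGlobalReg.radius_of_add_four`), take the IDENTITY rotation field and `σ x := bondDistSup S Ψ' x`, the largest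
  distortion of a `4`-bond at `x`; a window site with `σ x ≥ t₀ ≥ ϑ₀` owns a `ϑ₀`-wild bond inside `win (R + 4)`, so `strainMassAbove t₀ (win R) σ ≤
  wildMass ϑ₀ (win (R+4)) Ψ'`.

So, as far as the typed currencies see, (M) = (M♭)₀ consists of the (R_W)-part (M♭)_{ϑ₀} and the SUB-TAME part «(M♭)_ϑ, ϑ ∈ (0, ϑ₀)» — the formal
surplus of (M) over (R_W) (memo MEMO-g43-M.md §2: (M) is formally STRONGER than (R_W); with the Friesecke–James–Müller leaf (M) ⇒ (R_W) is part TY).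
No mechanism is claimed here: the file is glue for the line `_16XH19(_tol)` and fixes the currency `strainMassAbove` for the census instrument (F1).
-/


noncomputable section

open scoped BigOperators
open MeasureTheory Set Metric Filter Topology
open Summit.AtomisticToContinuum.Crystallization.Theorems.ChartedPlanarOrderRigidityDoor (E3 atomsIn)
open Summit.AtomisticToContinuum.Crystallization.Theorems.ChartedPlanarOrderDensityDichotomy (μS IsSep nK nK_nonneg)
open Summit.AtomisticToContinuum.Crystallization.Theorems.ChartedPlanarOrderCleanScaleP (IsCleanP IsDoorSetP)
open Summit.AtomisticToContinuum.Crystallization.Theorems.ChartedPlanarOrderMesoCut (LayeredHom EnvClose)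
open Summit.AtomisticToContinuum.Crystallization.Theorems.ChartedPlanarOrderDoorLayered (atomsIn_subset)
open Summit.AtomisticToContinuum.Crystallization.Theorems.ChartedPlanarOrderDoorLayeredOsc (IsTwoShellAffineGood)

namespace Summit.AtomisticToContinuum.Crystallization.Theorems.ChartedZeroExcessLayeredLatticeLiouville

/-! ### XX.5  (M♭)_ϑ «StrainSparsePG» and its dictionary with (M) and (R_W) -/

/-- ★★ **(M♭)_ϑ «StrainSparsePG ϑ aHi Λ θ s» — THE STRAIN OF A RE-REGISTRATION IS SPARSE ABOVE EVERY THRESHOLD `t₀ ≥ ϑ`, `t₀ > 0`.**  With (M)'s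
binder prefix (`∀ δ a Cg ∃ Cg' ≥ Cg`; then `∀ t₀ ≥ ϑ, t₀ > 0, ∀ ε K₀ ∃ η₁ R₁`): on every FAT window of a θ-good GSC door set registered by `Ψ` at
`(Cg, η, R)` to an equilibrium `s`-chart there are a re-registration `Ψ'` at `(Cg', η, R)` and tilt–strain data `(Q, σ)` for `Ψ'` with
`strainMassAbove t₀ (win R) σ ≤ ε·η·nK(win R)`.  DICTIONARY (this file, PROVED): (M) ⟺ (M♭)₀; (M♭)_ϑ is monotone in `ϑ`; (R_W) ⇒ (M♭)_{ϑ₀} (`ϑ₀ =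
tameRadius`).  The formal surplus of (M) over (R_W) is therefore «(M♭)_ϑ for ϑ ∈ (0, ϑ₀)»: sparseness of the strain BELOW the tame radius, modulo local
rotations — the sub-threshold (higher-integrability) content of the bad-set ε-regularity (A1) `WildReRegistrationPG`.  Same tags as (M): GENERIC ·
GSC-priced · UNDECIDED (hot spots) · TRUE-type expected in the defect-free regime.
Why it might fail: as (M) — hot spots of `O(1)` rigid misfit at density `≍ η` pin `strainMassAbove t₀ ≍ η·nK` for small `t₀`; for `ϑ ≥ ϑ₀` it is implied by
(R_W) and fails only with it.
Sources: as (M) (part TR): Meyers 1963; Gehring, Acta Math. 130 (1973) 265; Giaquinta–Modica 1979; [giaquinta1984 Ch. V Thm 1.2 / Prop 1.1]; this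
tree: `StrainNonConcentrationPG`, `WildFractionPG`; memo MEMO-g43-M.md (lens-2 g42). [this file, g42] -/
def StrainSparsePG (ϑ aHi Λ θ s : ℝ) : Prop :=
  ∀ δ : ℝ, 0 < δ → ∀ a : ℝ, 0 < a → ∀ Cg : ℝ, 1 ≤ Cg → ∃ Cg' : ℝ, Cg ≤ Cg' ∧
    ∀ t₀ : ℝ, ϑ ≤ t₀ → 0 < t₀ → ∀ ε : ℝ, 0 < ε → ∀ K₀ : ℝ, 0 < K₀ → ∃ η₁ : ℝ, 0 < η₁ ∧ ∃ R₁ : ℝ, 0 < R₁ ∧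
      ∀ S : Set E3, IsDoorSetPG aHi δ S → (∀ q ∈ S, IsTwoShellAffineGood θ S q) →
        ∀ η : ℝ, 0 < η → η ≤ η₁ → ∀ R : ℝ, R₁ ≤ R →
          ∀ (L : E3 ≃L[ℝ] E3) (w : ℤ → E3), IsEquilChart a s Λ L w →
            ∀ Ψ : E3 → E3, IsGlobalReg Cg η R S (LayeredHom (L : E3 →L[ℝ] E3) w) Ψ →
              K₀ ≤ η * nK (atomsIn (μS S) 0 R) →
                ∃ Ψ' : E3 → E3, IsGlobalReg Cg' η R S (LayeredHom (L : E3 →L[ℝ] E3) w) Ψ' ∧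
                  ∃ (Q : E3 → (E3 ≃ₗᵢ[ℝ] E3)) (σ : E3 → ℝ), IsTiltStrainData S R Ψ' Q σ ∧
                    strainMassAbove t₀ (atomsIn (μS S) 0 R) σ ≤ ε * η * nK (atomsIn (μS S) 0 R)

/-- (M♭)_ϑ is monotone in the threshold floor. [this file, g42] -/
theorem StrainSparsePG.mono {ϑ ϑ' aHi Λ θ s : ℝ} (hϑ : ϑ ≤ ϑ') (h : StrainSparsePG ϑ aHi Λ θ s) : StrainSparsePG ϑ' aHi Λ θ s := by
  intro δ hδ a ha Cg hCg
  obtain ⟨Cg', hCg', h'⟩ := h δ hδ a ha Cg hCg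
  exact ⟨Cg', hCg', fun t₀ ht₀ ht₀' => h' t₀ (hϑ.trans ht₀) ht₀'⟩

/-- ★ **(M) ⇒ (M♭)_ϑ (PROVED, Chebyshev)**: `strainMassAbove t₀ σ ≤ Σσ³/t₀`, so (M) at `ε·t₀` gives (M♭) at `ε`. [this file, g42] -/
theorem strainSparsePG_of_strainNonConcentrationPG {aHi Λ θ s : ℝ} (h : StrainNonConcentrationPG aHi Λ θ s) (ϑ : ℝ) :
    StrainSparsePG ϑ aHi Λ θ s := by
  intro δ hδ a ha Cg hCg
  obtain ⟨Cg', hCg', h'⟩ := h δ hδ a ha Cg hCg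
  refine ⟨Cg', hCg', fun t₀ _ ht₀ ε hε K₀ hK₀ => ?_⟩
  obtain ⟨η₁, hη₁, R₁, hR₁, h''⟩ := h' (t₀ * ε) (mul_pos ht₀ hε) K₀ hK₀
  refine ⟨η₁, hη₁, R₁, hR₁, fun S hS hgood η hη hηη₁ R hR L w hLw Ψ hΨ hfat => ?_⟩
  obtain ⟨Ψ', hΨ', Q, σ, hdata, hsum⟩ := h'' S hS hgood η hη hηη₁ R hR L w hLw Ψ hΨ hfat
  refine ⟨Ψ', hΨ', Q, σ, hdata, ?_⟩
  have hfin : (atomsIn (μS S) 0 R).Finite := finite_atomsIn hδ hS.1.2.1 R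
  have hσ0 := hdata.2.1
  have hpt : ∀ x ∈ atomsIn (μS S) 0 R, (if t₀ ≤ σ x then σ x ^ 2 else 0) ≤ t₀⁻¹ * σ x ^ 3 := by
    intro x _
    have hx0 : 0 ≤ σ x := hσ0 x
    split_ifs with ht
    · rw [le_inv_mul_iff₀ ht₀]
      calc t₀ * σ x ^ 2 ≤ σ x * σ x ^ 2 := mul_le_mul_of_nonneg_right ht (sq_nonneg _)
        _ = σ x ^ 3 := by ring
    · positivity
  calc strainMassAbove t₀ (atomsIn (μS S) 0 R) σ ≤ ∑ᶠ x ∈ atomsIn (μS S) 0 R, t₀⁻¹ * σ x ^ 3 := winsum_le_winsum_of_le hfin hpt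
    _ = t₀⁻¹ * ∑ᶠ x ∈ atomsIn (μS S) 0 R, σ x ^ 3 := winsum_const_mul hfin _ _
    _ ≤ t₀⁻¹ * (t₀ * ε * η * nK (atomsIn (μS S) 0 R)) := mul_le_mul_of_nonneg_left hsum (inv_nonneg.2 ht₀.le)
    _ = ε * η * nK (atomsIn (μS S) 0 R) := by field_simp

/-- ★★ **(M♭)₀ ⇒ (M) (PROVED; `aHi ≤ 8/7`)** — the sub-threshold strain is free.  Constants: `Cg' :=` (M♭)'s; given `ε`: `c := winDensC δ`,
`t₀ := ε/(8c²Cg')`, `ε♭ := ε/24`, `(η₁, R₁ ∨ 12)` from (M♭) at `(t₀, ε♭, K₀)`.  Data: with `τ` the registration profile of the re-registration `Ψ'` at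
scale `R + 4` and `τ⁺ := max τ 0`, set `σ' := min (min σ τ⁺) 12` and `Q' x := Q x` if `σ x ≤ τ⁺ x`, else `1`; then `(Q', σ')` are tilt–strain data
(`τ⁺` dominates the identity misfits on `win (R+4) ⊇` the `4`-neighbours of `win R`; every misfit is `≤ 12` by tear-freeness) and pointwise
`σ'³ ≤ t₀·τ⁺² + 12·[t₀ ≤ σ]σ²`, so `Σ_{win R} σ'³ ≤ t₀·Σ_{win (R+4)} τ² + 12·strainMassAbove t₀ σ ≤ t₀·2Cg'·η·c²·nK + 12·ε♭·η·nK ≤ ε·η·nK`. [this file, g42] -/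
theorem strainNonConcentrationPG_of_strainSparsePG {aHi Λ θ s : ℝ} (haHi : aHi ≤ 8 / 7) (h : StrainSparsePG 0 aHi Λ θ s) :
    StrainNonConcentrationPG aHi Λ θ s := by
  intro δ hδ a ha Cg hCg
  obtain ⟨Cg', hCg', h'⟩ := h δ hδ a ha Cg hCg
  refine ⟨Cg', hCg', fun ε hε K₀ hK₀ => ?_⟩
  have hCg'0 : 0 < Cg' := by linarith
  have hc1 : 1 ≤ winDensC δ := one_le_winDensC hδ
  have hc2 : 1 ≤ winDensC δ ^ 2 := one_le_pow₀ hc1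
  set t₀ : ℝ := ε / (8 * winDensC δ ^ 2 * Cg') with ht₀def
  have ht₀ : 0 < t₀ := by positivity
  obtain ⟨η₁, hη₁, R₁, hR₁, h''⟩ := h' t₀ ht₀.le ht₀ (ε / 24) (by positivity) K₀ hK₀
  refine ⟨η₁, hη₁, max R₁ 12, lt_max_of_lt_left hR₁, fun S hS hgood η hη hηη₁ R hR L w hLw Ψ hΨ hfat => ?_⟩
  have hR₁R : R₁ ≤ R := (le_max_left _ _).trans hR
  have hR12 : 12 ≤ R := (le_max_right _ _).trans hR
  obtain ⟨Ψ', hΨ', Q, σ, hdata, hmass⟩ := h'' S hS hgood η hη hηη₁ R hR₁R L w hLw Ψ hΨ hfat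
  refine ⟨Ψ', hΨ', ?_⟩
  obtain ⟨hdet, hσ0, hdomQ⟩ := hdata
  have htear := hΨ'.2.1
  -- the registration profile of `Ψ'` at scale `R + 4`
  obtain ⟨τ, -, -, henv, hdom, hgrad, -⟩ := hΨ'.2.2.2 (R + 4) (by linarith)
  set W := atomsIn (μS S) 0 R with hWdef
  set W4 := atomsIn (μS S) 0 (R + 4) with hW4def
  have hWS : W ⊆ S := atomsIn_subset S R
  have hWfin : W.Finite := finite_atomsIn hδ hS.1.2.1 R
  have hW4fin : W4.Finite := finite_atomsIn hδ hS.1.2.1 (R + 4)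
  have hWW4 : W ⊆ W4 := atomsIn_mono_radius (by linarith)
  -- merged and truncated data
  set τp : E3 → ℝ := fun x => max (τ x) 0 with hτpdef
  set Q' : E3 → (E3 ≃ₗᵢ[ℝ] E3) := fun x => if σ x ≤ τp x then Q x else LinearIsometryEquiv.refl ℝ E3 with hQ'def
  set σ' : E3 → ℝ := fun x => min (min (σ x) (τp x)) 12 with hσ'def
  have hτp0 : ∀ x, 0 ≤ τp x := fun x => le_max_right _ _
  have hσ'0 : ∀ x, 0 ≤ σ' x := fun x => le_min (le_min (hσ0 x) (hτp0 x)) (by norm_num)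
  have hσ'σ : ∀ x, σ' x ≤ σ x := fun x => (min_le_left _ _).trans (min_le_left _ _)
  have hσ'τ : ∀ x, σ' x ≤ τp x := fun x => (min_le_left _ _).trans (min_le_right _ _)
  have hσ'12 : ∀ x, σ' x ≤ 12 := fun x => min_le_right _ _
  refine ⟨Q', σ', ⟨fun x => ?_, hσ'0, fun x hx p hp hpx => ?_⟩, ?_⟩
  · -- determinant `1`
    by_cases hc : σ x ≤ τp x
    · simp only [hQ'def, if_pos hc]; exact hdet x
    · simp only [hQ'def, if_neg hc]; exact det_refl_E3_eq_one
  · -- domination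
    have hxS : x ∈ S := hWS hx
    have h12 : dist ((Q' x) (p - x)) (Ψ' p - Ψ' x) ≤ 12 := dist_rot_bond_le_twelve htear (Q' x) hxS hp hpx
    have hx4 : x ∈ W4 := hWW4 hx
    have hp4 : p ∈ W4 := mem_atomsIn_add_four hx hp hpx
    have hidτ : dist (p - x) (Ψ' p - Ψ' x) ≤ τp x := (hdom x hx4 p hp4 hpx).trans (le_max_left _ _)
    refine le_min (le_min ?_ ?_) h12
    · by_cases hc : σ x ≤ τp x
      · simp only [hQ'def, if_pos hc]; exact hdomQ x hx p hp hpx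
      · simp only [hQ'def, if_neg hc, LinearIsometryEquiv.coe_refl, id_eq]
        exact hidτ.trans (not_le.1 hc).le
    · by_cases hc : σ x ≤ τp x
      · simp only [hQ'def, if_pos hc]; exact (hdomQ x hx p hp hpx).trans hc
      · simp only [hQ'def, if_neg hc, LinearIsometryEquiv.coe_refl, id_eq]; exact hidτ
  · -- the cubic sum
    have hpt : ∀ x ∈ W, σ' x ^ 3 ≤ t₀ * τp x ^ 2 + 12 * (if t₀ ≤ σ x then σ x ^ 2 else 0) := by
      intro x _
      have h0 := hσ'0 x
      have hsqτ : σ' x ^ 2 ≤ τp x ^ 2 := pow_le_pow_left₀ h0 (hσ'τ x) 2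
      have hsqσ : σ' x ^ 2 ≤ σ x ^ 2 := pow_le_pow_left₀ h0 (hσ'σ x) 2
      have hcube : σ' x ^ 3 = σ' x * σ' x ^ 2 := by ring
      by_cases ht : t₀ ≤ σ x
      · rw [if_pos ht, hcube]
        have h1 : σ' x * σ' x ^ 2 ≤ 12 * σ x ^ 2 := mul_le_mul (hσ'12 x) hsqσ (sq_nonneg _) (by norm_num)
        nlinarith [sq_nonneg (τp x), ht₀.le]
      · rw [if_neg ht, mul_zero, add_zero, hcube]
        have hlt : σ' x ≤ t₀ := (hσ'σ x).trans (not_le.1 ht).le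
        exact mul_le_mul hlt hsqτ (sq_nonneg _) ht₀.le
    -- the profile sum at scale `R + 4`
    have hτsum : ∑ᶠ x ∈ W, τp x ^ 2 ≤ 2 * Cg' * η * (winDensC δ ^ 2 * nK W) := by
      have h1 : ∑ᶠ x ∈ W, τp x ^ 2 ≤ ∑ᶠ x ∈ W4, τp x ^ 2 := finsum_mem_le_finsum_mem_of_subset_of_nonneg hW4fin hWW4 fun x _ => sq_nonneg _
      have h2 : ∑ᶠ x ∈ W4, τp x ^ 2 = ∑ᶠ x ∈ W4, τ x ^ 2 := by
        refine finsum_mem_congr rfl fun x hx => ?_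
        simp only [hτpdef, max_eq_left (henv x hx).1]
      have hRpos : 0 < R := by linarith
      have h3 : Cg' * ((R + 4) / R) * η ≤ 2 * Cg' * η := by
        have : (R + 4) / R ≤ 2 := by rw [div_le_iff₀ hRpos]; linarith
        have h' : Cg' * ((R + 4) / R) ≤ Cg' * 2 := mul_le_mul_of_nonneg_left this hCg'0.le
        nlinarith [hη.le]
      have hdens : nK W4 ≤ winDensC δ ^ 2 * nK W := nK_atomsIn_add_four_le haHi hδ hS.1 hR12
      calc ∑ᶠ x ∈ W, τp x ^ 2 ≤ ∑ᶠ x ∈ W4, τ x ^ 2 := h1.trans_eq h2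
        _ ≤ Cg' * ((R + 4) / R) * η * nK W4 := hgrad
        _ ≤ 2 * Cg' * η * nK W4 := mul_le_mul_of_nonneg_right h3 (nK_nonneg _)
        _ ≤ 2 * Cg' * η * (winDensC δ ^ 2 * nK W) := mul_le_mul_of_nonneg_left hdens (by positivity)
    have hmass' : ∑ᶠ x ∈ W, (if t₀ ≤ σ x then σ x ^ 2 else 0) ≤ ε / 24 * η * nK W := hmass
    have hnW := nK_nonneg W
    calc ∑ᶠ x ∈ W, σ' x ^ 3 ≤ ∑ᶠ x ∈ W, (t₀ * τp x ^ 2 + 12 * (if t₀ ≤ σ x then σ x ^ 2 else 0)) := winsum_le_winsum_of_le hWfin hpt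
      _ = t₀ * ∑ᶠ x ∈ W, τp x ^ 2 + 12 * ∑ᶠ x ∈ W, (if t₀ ≤ σ x then σ x ^ 2 else 0) := winsum_add_mul_eq hWfin _ _ _ _
      _ ≤ t₀ * (2 * Cg' * η * (winDensC δ ^ 2 * nK W)) + 12 * (ε / 24 * η * nK W) :=
          add_le_add (mul_le_mul_of_nonneg_left hτsum ht₀.le) (mul_le_mul_of_nonneg_left hmass' (by norm_num))
      _ = (3 / 4 * ε) * η * nK W := by rw [ht₀def]; field_simp; ring
      _ ≤ ε * η * nK W := by
          have : 0 ≤ η * nK W := mul_nonneg hη.le hnW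
          nlinarith

/-- ★ **(M) ⟺ (M♭)₀ (PROVED; `aHi ≤ 8/7`).** [this file, g42] -/
theorem strainNonConcentrationPG_iff_strainSparsePG_zero {aHi Λ θ s : ℝ} (haHi : aHi ≤ 8 / 7) :
    StrainNonConcentrationPG aHi Λ θ s ↔ StrainSparsePG 0 aHi Λ θ s :=
  ⟨fun h => strainSparsePG_of_strainNonConcentrationPG h 0, strainNonConcentrationPG_of_strainSparsePG haHi⟩

/-- ★★ **(R_W) ⇒ (M♭)_{ϑ₀} (PROVED; `aHi ≤ 8/7`, `ϑ₀ = tameRadius`)** — above the tame radius, strain sparseness IS wild-bond sparseness.  Constants: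
(R_W) at `(δ, a, 2Cg)` gives `C_W`; `Cg' := 4c²·C_W`; given `(t₀ ≥ ϑ₀, ε, K₀)`: (R_W) at `(ε/c², K₀)` gives `(η₁, R₁)`, floor `R₁ ∨ 12`.  On a window
of radius `R`: the registration at `(Cg, η, R)` is one at `(2Cg, η, R+4)`, fat windows stay fat, (R_W) re-registers at radius `R + 4` with
`wildMass ϑ₀ (win (R+4)) Ψ' ≤ (ε/c²)·η·nK(win (R+4)) ≤ ε·η·nK(win R)`, the re-registration is global at `(4c²C_W, η, R)`, and with the identity
rotations and `σ := bondDistSup S Ψ'` (tilt–strain data) every site of `win R` with `σ x ≥ t₀ ≥ ϑ₀` contributes its attained bond `(x, p⋆)`,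
`p⋆ ∈ win (R+4)`, of squared distortion `σ x²` to the wild mass: `strainMassAbove t₀ (win R) σ ≤ wildMass ϑ₀ (win (R+4)) Ψ'`. [this file, g42] -/
theorem strainSparsePG_tameRadius_of_wildFractionPG {aHi Λ θ s : ℝ} (haHi : aHi ≤ 8 / 7) (h : WildFractionPG aHi Λ θ s) :
    StrainSparsePG tameRadius aHi Λ θ s := by
  intro δ hδ a ha Cg hCg
  obtain ⟨CW, hCW, hW⟩ := h δ hδ a ha (2 * Cg) (by linarith)
  have hc1 : 1 ≤ winDensC δ := one_le_winDensC hδ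
  have hc2 : 1 ≤ winDensC δ ^ 2 := one_le_pow₀ hc1
  have hc2pos : 0 < winDensC δ ^ 2 := by positivity
  have hCW0 : 0 ≤ CW := by linarith
  refine ⟨4 * winDensC δ ^ 2 * CW, ?_, fun t₀ ht₀ ht₀pos ε hε K₀ hK₀ => ?_⟩
  · have h0 : 0 ≤ CW := hCW0
    calc Cg ≤ CW := by linarith
      _ = 1 * CW := by ring
      _ ≤ 4 * winDensC δ ^ 2 * CW := mul_le_mul_of_nonneg_right (by nlinarith) h0
  obtain ⟨η₁, hη₁, R₁, hR₁, hW'⟩ := hW (ε / winDensC δ ^ 2) (by positivity) K₀ hK₀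
  refine ⟨η₁, hη₁, max R₁ 12, lt_max_of_lt_left hR₁, fun S hS hgood η hη hηη₁ R hR L w hLw Ψ hΨ hfat => ?_⟩
  have hR₁R : R₁ ≤ R := (le_max_left _ _).trans hR
  have hR12 : 12 ≤ R := (le_max_right _ _).trans hR
  set W := atomsIn (μS S) 0 R with hWdef
  set W4 := atomsIn (μS S) 0 (R + 4) with hW4def
  have hsep : IsSep δ S := hS.1.2.1
  have hWS : W ⊆ S := atomsIn_subset S R
  have hWfin : W.Finite := finite_atomsIn hδ hsep R
  have hW4fin : W4.Finite := finite_atomsIn hδ hsep (R + 4)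
  have hWW4 : W ⊆ W4 := atomsIn_mono_radius (by linarith)
  have hdens : nK W4 ≤ winDensC δ ^ 2 * nK W := nK_atomsIn_add_four_le haHi hδ hS.1 hR12
  -- (R_W) at radius `R + 4`
  have hΨ4 : IsGlobalReg (2 * Cg) η (R + 4) S (LayeredHom (L : E3 →L[ℝ] E3) w) Ψ := hΨ.radius_add_four (by linarith) hη.le (by linarith)
  have hfat4 : K₀ ≤ η * nK W4 := hfat.trans (mul_le_mul_of_nonneg_left (nK_le_nK_of_subset hW4fin hWW4) hη.le)
  obtain ⟨Ψ', hΨ', hwild⟩ := hW' S hS hgood η hη hηη₁ (R + 4) (by linarith) L w hLw Ψ hΨ4 hfat4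
  refine ⟨Ψ', hΨ'.radius_of_add_four haHi hδ hS.1 hCW0 hη.le hR12, fun _ => LinearIsometryEquiv.refl ℝ E3, bondDistSup S Ψ',
    ⟨fun _ => det_refl_E3_eq_one, bondDistSup_nonneg S Ψ', fun x _ p hp hpx => ?_⟩, ?_⟩
  · simp only [LinearIsometryEquiv.coe_refl, id_eq]
    exact dist_bond_le_bondDistSup hδ hsep Ψ' hp hpx
  · -- `strainMassAbove t₀ (win R) (bondDistSup S Ψ') ≤ wildMass ϑ₀ (win (R+4)) Ψ'`
    have hinner0 : ∀ x : E3, 0 ≤ ∑ᶠ p ∈ W4 ∩ closedBall x 4,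
        (if tameRadius ≤ dist (p - x) (Ψ' p - Ψ' x) then dist (p - x) (Ψ' p - Ψ' x) ^ 2 else 0) := by
      intro x
      exact finsum_nonneg fun p => finsum_nonneg fun _ => by split_ifs <;> positivity
    have hpt : ∀ x ∈ W, (if t₀ ≤ bondDistSup S Ψ' x then bondDistSup S Ψ' x ^ 2 else 0) ≤
        ∑ᶠ p ∈ W4 ∩ closedBall x 4, (if tameRadius ≤ dist (p - x) (Ψ' p - Ψ' x) then dist (p - x) (Ψ' p - Ψ' x) ^ 2 else 0) := by
      intro x hx
      split_ifs with ht
      · have hpos : 0 < bondDistSup S Ψ' x := ht₀pos.trans_le ht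
        obtain ⟨p, hpS, hpx, hpeq⟩ := exists_bond_eq_bondDistSup hδ hsep Ψ' (hWS hx) hpos
        have hp4 : p ∈ W4 ∩ closedBall x 4 := ⟨mem_atomsIn_add_four hx hpS hpx, mem_closedBall.2 hpx⟩
        have hfin : (W4 ∩ closedBall x 4).Finite := hW4fin.inter_of_left _
        have hterm : (if tameRadius ≤ dist (p - x) (Ψ' p - Ψ' x) then dist (p - x) (Ψ' p - Ψ' x) ^ 2 else 0) = bondDistSup S Ψ' x ^ 2 := by
          rw [hpeq, if_pos (ht₀.trans ht)]
        have hnn : ∀ q ∈ W4 ∩ closedBall x 4,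
            0 ≤ (if tameRadius ≤ dist (q - x) (Ψ' q - Ψ' x) then dist (q - x) (Ψ' q - Ψ' x) ^ 2 else 0) :=
          fun q _ => by split_ifs <;> positivity
        rw [← hterm]
        exact le_winsum_of_mem hfin hnn hp4
      · exact hinner0 x
    calc strainMassAbove t₀ W (bondDistSup S Ψ')
        ≤ ∑ᶠ x ∈ W, ∑ᶠ p ∈ W4 ∩ closedBall x 4,
            (if tameRadius ≤ dist (p - x) (Ψ' p - Ψ' x) then dist (p - x) (Ψ' p - Ψ' x) ^ 2 else 0) := winsum_le_winsum_of_le hWfin hpt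
      _ ≤ ∑ᶠ x ∈ W4, ∑ᶠ p ∈ W4 ∩ closedBall x 4,
            (if tameRadius ≤ dist (p - x) (Ψ' p - Ψ' x) then dist (p - x) (Ψ' p - Ψ' x) ^ 2 else 0) :=
          finsum_mem_le_finsum_mem_of_subset_of_nonneg hW4fin hWW4 fun x _ => hinner0 x
      _ = wildMass tameRadius W4 Ψ' := rfl
      _ ≤ ε / winDensC δ ^ 2 * η * nK W4 := hwild
      _ ≤ ε / winDensC δ ^ 2 * η * (winDensC δ ^ 2 * nK W) := mul_le_mul_of_nonneg_left hdens (by positivity)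
      _ = ε * η * nK W := by field_simp

end Summit.AtomisticToContinuum.Crystallization.Theorems.ChartedZeroExcessLayeredLatticeLiouville

end
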